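import Literature.IUT.HodgeArakelov.PlusMinusTowerStableCurveBridgeH25
import Literature.IUT.HodgeTheaters.TemperedCoveringsCompactSubgroups
import HarnessLib

/-!
# Bridge B13, input (A) of [IUTchII] Cor 2.4 (i): the pro-`Σ` datum in abc-iut-L5-t11's per-cusp form

Mochizuki, *Inter-universal Teichmüller Theory I*, kurims manuscript (May 2020), §2, proof of Cor 2.5, p.51:
"when `x` is a cusp of `X` [so `I_x ≅ Ẑ`], it follows — i.e., by applying Proposition 2.4, (i), to the unique maximal
pro-`Σ` subgroup of `I_x` — that … a `Π̂_X`-conjugate of `Π^tp_X` contains `I_x` if and only if it is, in fact, equal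
to `Π^tp_X`"; and p.51 (proof of Prop 2.4 (iii)): "by allowing … `Λ` to range over the open subgroups of a pro-`Σ`
Sylow subgroup"; *Inter-universal Teichmüller Theory II*, kurims (Dec. 2020), §2, Cor 2.4 (i) pp.69–71, Rmk 2.4.1 p.71
[cite: Mochizuki2012, I Cor 2.5 p.51, II Cor 2.4 (i) pp.69–71] (D-0012 claim key, status disputed; PROOF-ONLY
companion of `PlusMinusTowerStableCurveBridgeH25` (abc-iut-w5-d121, p413689) — no definition, nothing of the series is
asserted).

`PlusMinusTowerStableCurveBridgeH25` delivers input (A) of [IUTchII] Cor 2.4 (i) at the node's `Π_v`-cuspidal `I_t`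
from a pro-`Σ` datum `hP` quantified over the finite-index subgroups `J` of the `Π^tp`-conjugates of the representative
inertia groups `I_x`.  This file DERIVES that datum — in the form the proof needs — from the PER-CUSP datum in the shape
abc-iut-L5-t11 already uses for [IUTchI] Prop 2.4 (iii) / Cor 2.5 (`TemperedCoveringsCompactSubgroups`,
`delta_isCommensurablyTerminal_of_prop24i'`; `TemperedCoveringsProofs`, `cor25Inertia_of_prop24i`): for every cusp
`x`, an infinite profinite (compact, totally disconnected) pro-`Σ` subgroup `P ⊆ I_x` ("the unique maximal pro-`Σ`
subgroup of `I_x ≅ Ẑ`", at the model `ℤ_l(1)` for `Σ = {l}`), with `Π^tp_X` Hausdorff.  The step "the open subgroups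
of a pro-`Σ` Sylow subgroup" is abc-iut-L5-t11's ELEMENTARY `exists_compact_le_inf_of_finiteIndex` +
`isProSigma_subgroup` (no [NS]); here it is run inside the ambient group `I_x`, where the finite-index hypothesis lives.

* `Subgroup.exists_proSigma_le_map_le_of_relIndex` — pure topological group theory: for `P ⊆ I ⊆ T` with `P` infinite
  profinite pro-`Σ` (`T` Hausdorff), a homomorphism `f : T → M` and `J ⊆ M` of finite index in `f(I)`, there is a
  nontrivial compact pro-`Σ` subgroup `Q ⊆ P` with `f(Q) ⊆ J`;
* `StableCurveTemperedData.conj_range_eq_of_conj_proSigma_le` — the `t`-conjugated form of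
  `conj_range_eq_of_proSigma_le` (Prop 2.4 (i) ⟹ a conjugate of `Π^tp_X` containing `(P^t)` equals `Π^tp_X`);
* `PlusMinusTower.StableCurveAgreement.inputA1_of_proSigmaPart` / `h25_piV_of_proSigmaPart` /
  `h25_piV_of_proSigmaPart_of_prop24iii` — (A1) and the binder `h25` of `cor24_i_of_inputs` at the node's
  `Π_v`-cuspidal `I`, with the datum in the per-cusp form (everything else as in p413689: the agreement, `D.Prop24i`,
  `Def23_ii C W.piV W.piPM`, normal terminality / `D.Prop24iii` — all HYPOTHESES).

HONEST FRAMING: kernel checks of deductions between typed statements over abstract data; typed ≠ proved; nothing here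
bears on [IUTchIII] Cor 3.12.
-/

open scoped Pointwise

universe u

/-! ### Pure topological group theory -/

namespace Subgroup

open Literature.AnabelianGeometry.SemiGraphs (IsProSigma)
open Literature.IUT.HodgeTheaters (exists_compact_le_inf_of_finiteIndex isProSigma_subgroup
  isProSigma_of_surjective)

/-- The canonical isomorphism `H.subgroupOf K ≃* H` (`H ≤ K`) is continuous for the subspace topologies.
[folklore] -/
private theorem continuous_subgroupOfEquivOfLe {T : Type*} [Group T] [TopologicalSpace T]
    {H K : Subgroup T} (h : H ≤ K) : Continuous (Subgroup.subgroupOfEquivOfLe h) := by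
  refine continuous_induced_rng.2 ?_
  have e : (Subtype.val ∘ ⇑(Subgroup.subgroupOfEquivOfLe h)) =
      fun g : H.subgroupOf K => ((g : K) : T) := by
    funext g
    rfl
  rw [e]
  exact continuous_subtype_val.comp continuous_subtype_val

/-- **"The open subgroups of a pro-`Σ` Sylow subgroup of `I_x`"** ([IUTchI] Cor 2.5 proof p.51 / Prop 2.4 (iii)
proof p.51, in abc-iut-L5-t11's elementary form).  In a Hausdorff topological group `T`, let `P ⊆ I` be subgroups with
`P` an infinite compact, totally disconnected, pro-`Σ` subgroup; let `f : T → M` be a homomorphism and `J ⊆ M` a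
subgroup meeting `f(I)` with finite index.  Then some nontrivial compact pro-`Σ` subgroup `Q ⊆ P` has `f(Q) ⊆ J`.
[Apply `exists_compact_le_inf_of_finiteIndex` inside `I` to `P` and `f⁻¹(J) ∩ I`; pro-`Σ` passes to the subgroup
`Q ⊆ P` by `isProSigma_subgroup`.]  PROVED. [claim: Mochizuki2012, status: disputed] -/
theorem exists_proSigma_le_map_le_of_relIndex {S : Set ℕ} {T : Type*} [Group T] [TopologicalSpace T]
    [IsTopologicalGroup T] [T2Space T] {M : Type*} [Group M] (I P : Subgroup T) (hPI : P ≤ I)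
    (hPc : IsCompact (P : Set T)) (hPinf : (P : Set T).Infinite) (hPS : IsProSigma S P)
    (hPtd : TotallyDisconnectedSpace P) (f : T →* M) (J : Subgroup M)
    (hJ : J.relIndex (I.map f) ≠ 0) :
    ∃ Q : Subgroup T, Q ≤ P ∧ Q.map f ≤ J ∧ IsCompact (Q : Set T) ∧ Q ≠ ⊥ ∧ IsProSigma S Q := by
  -- work inside the ambient group `I`
  set V : Subgroup I := P.subgroupOf I with hV
  set N : Subgroup I := (J.comap f).subgroupOf I with hN
  have hVimg : Subtype.val '' (V : Set I) = (P : Set T) := by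
    ext y
    constructor
    · rintro ⟨z, hz, rfl⟩
      exact Subgroup.mem_subgroupOf.mp hz
    · intro hy
      exact ⟨⟨y, hPI hy⟩, Subgroup.mem_subgroupOf.mpr hy, rfl⟩
  have hVc : IsCompact (V : Set I) := by
    rw [Topology.IsEmbedding.subtypeVal.isCompact_iff, hVimg]
    exact hPc
  have hVinf : (V : Set I).Infinite := by
    refine Set.Infinite.of_image Subtype.val ?_
    rw [hVimg]
    exact hPinf
  haveI hNfi : N.FiniteIndex := by
    refine ⟨?_⟩
    change (J.comap f).relIndex I ≠ 0
    rw [Subgroup.relIndex_comap]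
    exact hJ
  obtain ⟨Λ, hΛle, hΛc, hΛne⟩ := exists_compact_le_inf_of_finiteIndex hVc hVinf N
  -- push `Λ ⊆ I` back into `T`
  set Q : Subgroup T := Λ.map I.subtype with hQ
  have hQP : Q ≤ P := by
    rintro _ ⟨z, hz, rfl⟩
    exact Subgroup.mem_subgroupOf.mp (hΛle hz).1
  refine ⟨Q, hQP, ?_, ?_, ?_, ?_⟩
  · rintro _ ⟨_, ⟨z, hz, rfl⟩, rfl⟩
    exact Subgroup.mem_subgroupOf.mp (hΛle hz).2
  · rw [hQ, Subgroup.coe_map]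
    exact hΛc.image continuous_subtype_val
  · rw [hQ, Ne, Λ.map_eq_bot_iff_of_injective I.subtype_injective]
    exact hΛne
  · -- `Q ⊆ P` is a subgroup of the profinite pro-`Σ` group `P`
    haveI : CompactSpace P := isCompact_iff_compactSpace.mp hPc
    exact isProSigma_of_surjective (isProSigma_subgroup hPS (Q.subgroupOf P))
      (Subgroup.subgroupOfEquivOfLe hQP).toMonoidHom (continuous_subgroupOfEquivOfLe hQP)
      (Subgroup.subgroupOfEquivOfLe hQP).surjective

end Subgroup

/-! ### [IUTchI] Prop 2.4 (i) consequence, `t`-conjugated form -/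

namespace Literature.IUT.HodgeTheaters

namespace StableCurveTemperedData

open Literature.AnabelianGeometry.SemiGraphs (IsProSigma)

variable (D : StableCurveTemperedData.{u})

/-- **[IUTchI] Cor 2.5, proof for cusps** (kurims p.51), `t`-conjugated form of
`conj_range_eq_of_proSigma_le`: GIVEN Prop 2.4 (i) (`h`), if a `Π̂_X`-conjugate `(Π^tp_X)^γ` contains the
`Π^tp_X`-conjugate `(P)^t` of a nontrivial compact pro-`Σ` subgroup `P ⊆ Δ^tp_X` (`t ∈ Π^tp_X`), then
`(Π^tp_X)^γ = Π^tp_X`.  [Reduce to `γ' := ι(t)⁻¹ γ`.] PROVED. [claim: Mochizuki2012, status: disputed] -/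
theorem conj_range_eq_of_conj_proSigma_le (h : D.Prop24i) (P : Subgroup D.DeltaTp)
    (hPc : IsCompact (P : Set D.DeltaTp)) (hPne : P ≠ ⊥) (hPS : IsProSigma D.graph.Sigma P)
    (t : D.PiTp) (γ : D.PiHat)
    (hle : (MulAut.conj t • P.map D.DeltaTp.subtype).map D.ιX ≤ MulAut.conj γ • D.ιX.range) :
    MulAut.conj γ • D.ιX.range = D.ιX.range := by
  -- `P ⊆ (Π^tp_X)^{ι(t)⁻¹ γ}`
  have hle' : (P.map D.DeltaTp.subtype).map D.ιX ≤ MulAut.conj ((D.ιX t)⁻¹ * γ) • D.ιX.range := by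
    rintro _ ⟨_, ⟨p, hp, rfl⟩, rfl⟩
    have hmem : D.ιX (t * (p : D.PiTp) * t⁻¹) ∈ MulAut.conj γ • D.ιX.range :=
      hle ⟨t * (p : D.PiTp) * t⁻¹, Subgroup.smul_mem_pointwise_smul _ _ _ ⟨p, hp, rfl⟩, rfl⟩
    rw [Subgroup.mem_pointwise_smul_iff_inv_smul_mem, MulAut.smul_def, MulAut.conj_inv_apply] at hmem ⊢
    have e : ((D.ιX t)⁻¹ * γ)⁻¹ * D.ιX (D.DeltaTp.subtype p) * ((D.ιX t)⁻¹ * γ) =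
        γ⁻¹ * D.ιX (t * (p : D.PiTp) * t⁻¹) * γ := by
      simp only [Subgroup.coe_subtype, map_mul, map_inv, mul_inv_rev, inv_inv]
      group
    rw [e]
    exact hmem
  have heq := D.conj_range_eq_of_proSigma_le h P hPc hPne hPS ((D.ιX t)⁻¹ * γ) hle'
  -- `(Π^tp)^γ = (Π^tp)^{ι(t) · (ι(t)⁻¹ γ)} = ((Π^tp)^{ι(t)⁻¹γ})^{ι(t)} = (Π^tp)^{ι(t)} = Π^tp`
  have e : γ = D.ιX t * ((D.ιX t)⁻¹ * γ) := by rw [mul_inv_cancel_left]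
  rw [e, map_mul, mul_smul, heq]
  exact Subgroup.conj_smul_eq_self_of_mem ⟨t, rfl⟩

end StableCurveTemperedData

end Literature.IUT.HodgeTheaters

/-! ### The bridge: input (A) from the per-cusp pro-`Σ` datum -/

namespace Literature.IUT.HodgeArakelov

open Literature.IUT.HodgeTheaters
open Literature.AnabelianGeometry.AbsoluteAnabelian (IsNormallyTerminal)
open Literature.AnabelianGeometry.SemiGraphs (IsProSigma)

variable {S : BadPlaceSetting.{u}} {P : TopGroup.{u}} {T : TemperedCoverings S P}

namespace PlusMinusTower

namespace StableCurveAgreement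

variable {W : PlusMinusTower T} {C : CuspidalInertiaData W} {D : StableCurveTemperedData.{u}}

/-- **IUTchI:Cor2.5** (kurims p.51) **Input (A1) of [IUTchII] Cor 2.4 (i) at the node's `Π_v`-cuspidal inertia group, per-cusp datum.**
As `inputA1_of_prop24i` (p413689), with the pro-`Σ` datum in abc-iut-L5-t11's PER-CUSP form: for every cusp `x` an
infinite profinite pro-`Σ` subgroup `P ⊆ I_x` ("the unique maximal pro-`Σ` subgroup of `I_x`"), `Π^tp_{X_v}` Hausdorff.
HYPOTHESES (named, none asserted): the B13 agreement, `D.Prop24i`, abc-iut-L6-t1's `Def23_ii C W.piV W.piPM`, the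
datum `hPx`.  PROVED. [claim: Mochizuki2012, status: disputed] -/
theorem inputA1_of_proSigmaPart [T2Space D.PiTp] (A : StableCurveAgreement W C D) (h24i : D.Prop24i)
    (hrel : Def23_ii C W.piV W.piPM)
    (hPx : ∀ x : D.Cusp, ∃ Q : Subgroup D.DeltaTp, Q ≤ D.inertiaTp x ∧ IsCompact (Q : Set D.DeltaTp) ∧
      (Q : Set D.DeltaTp).Infinite ∧ IsProSigma D.graph.Sigma Q ∧ TotallyDisconnectedSpace Q)
    {I : Subgroup W.Corhat} (hI : C.IsCuspidalInertia W.piV I) :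
    ∀ γ : W.Corhat, γ ∈ W.pmHat → I ≤ W.piPM.map (MulAut.conj γ).toMonoidHom →
      W.piPM.map (MulAut.conj γ).toMonoidHom = W.piPM := by
  intro γ hγ hc
  -- Def 2.3 (ii): `I = I' ∩ Π_v`, finite index in a cuspidal inertia group `I'` of `Π^±_v`
  obtain ⟨I', hI', hfi, rfl⟩ := (hrel.2.1 I).mp hI
  -- the agreement: `I' ⊆ Π^±_v` is carried onto a `Π^tp_{X_v}`-conjugate of some `I_x`
  obtain ⟨hI'pm, x, t, hK⟩ := (A.inertia_iff I').mp hI'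
  have hI'hat : I' ≤ W.pmHat := hI'pm.trans W.emb_le_pmHat
  set g : D.PiHat := A.eHat ⟨γ, hγ⟩ with hg
  -- the homomorphism `d ↦ ι(t d t⁻¹)` on `Δ^tp_{X_v}`, whose image of `I_x` is the conjugate of the agreement
  set f : D.DeltaTp →* D.PiHat := (D.ιX.comp (MulAut.conj t).toMonoidHom).comp D.DeltaTp.subtype with hf
  have hKf : (MulAut.conj t • (D.inertiaTp x).map D.DeltaTp.subtype).map D.ιX = (D.inertiaTp x).map f := by
    ext y
    simp only [hf, Subgroup.mem_map, MonoidHom.coe_comp, Function.comp_apply, Subgroup.coe_subtype,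
      MulEquiv.coe_toMonoidHom, MulAut.conj_apply, Subgroup.mem_pointwise_smul_iff_inv_smul_mem,
      MulAut.smul_def, MulAut.conj_inv_apply]
    constructor
    · rintro ⟨z, ⟨p, hp, hpz⟩, rfl⟩
      refine ⟨p, hp, ?_⟩
      have e : (p : D.PiTp) = t⁻¹ * z * t := hpz
      rw [e]; congr 1; group
    · rintro ⟨p, hp, rfl⟩
      exact ⟨t * (p : D.PiTp) * t⁻¹, ⟨p, hp, by group⟩, rfl⟩
  set J : Subgroup D.PiHat := ((I' ⊓ W.piV).subgroupOf W.pmHat).map A.eHat.toMonoidHom with hJ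
  -- `J ⊆ f(I_x)`, of finite index
  have hJfi : J.relIndex ((D.inertiaTp x).map f) ≠ 0 := by
    rw [← hKf, hJ, ← hK, Subgroup.relIndex_map_map_of_injective _ _ A.eHat.injective,
      Subgroup.relIndex_subgroupOf hI'hat]
    exact hfi.index_ne_zero
  -- `J ⊆ (Π^tp_{X_v})^g`, transported from `I' ∩ Π_v ⊆ (Π^±_v)^γ`
  have hJg : J ≤ MulAut.conj g • D.ιX.range := by
    rintro _ ⟨q, hq, rfl⟩
    have hqI : (q : W.Corhat) ∈ I' ⊓ W.piV := Subgroup.mem_subgroupOf.mp hq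
    have hq' : γ⁻¹ * (q : W.Corhat) * γ ∈ W.piPM := by
      have := hc hqI
      rwa [Subgroup.mem_map_equiv, MulAut.conj_symm_apply] at this
    rw [Subgroup.mem_pointwise_smul_iff_inv_smul_mem, MulAut.smul_def, MulAut.conj_inv_apply,
      MulEquiv.coe_toMonoidHom, hg, ← A.eHat_conj_inv hγ q.2]
    exact (A.mem_piPM_iff ⟨_, _⟩).mp hq'
  -- the pro-`Σ` part of `I_x`, cut down to `J`, then Prop 2.4 (i)
  obtain ⟨P₀, hP₀I, hP₀c, hP₀inf, hP₀S, hP₀td⟩ := hPx x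
  obtain ⟨Q, -, hQJ, hQc, hQne, hQS⟩ :=
    Subgroup.exists_proSigma_le_map_le_of_relIndex (D.inertiaTp x) P₀ hP₀I hP₀c hP₀inf hP₀S hP₀td f J hJfi
  have hQf : (MulAut.conj t • Q.map D.DeltaTp.subtype).map D.ιX = Q.map f := by
    ext y
    simp only [hf, Subgroup.mem_map, MonoidHom.coe_comp, Function.comp_apply, Subgroup.coe_subtype,
      MulEquiv.coe_toMonoidHom, MulAut.conj_apply, Subgroup.mem_pointwise_smul_iff_inv_smul_mem,
      MulAut.smul_def, MulAut.conj_inv_apply]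
    constructor
    · rintro ⟨z, ⟨p, hp, hpz⟩, rfl⟩
      refine ⟨p, hp, ?_⟩
      have e : (p : D.PiTp) = t⁻¹ * z * t := hpz
      rw [e]; congr 1; group
    · rintro ⟨p, hp, rfl⟩
      exact ⟨t * (p : D.PiTp) * t⁻¹, ⟨p, hp, by group⟩, rfl⟩
  have heq : MulAut.conj g • D.ιX.range = D.ιX.range :=
    D.conj_range_eq_of_conj_proSigma_le h24i Q hQc hQne hQS t g (hQf ▸ hQJ.trans hJg)
  exact (A.conj_piPM_eq_iff hγ).mpr heq

/-- **IUTchII:Cor2.4(i)** (kurims p.70 l.−3) **The binder `h25` of `cor24_i_of_inputs` at the node's `Π_v`-cuspidal `I`,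
per-cusp datum** (as `h25_piV`, p413689, with `hP` replaced by the per-cusp pro-`Σ` part `hPx`). PROVED.
[claim: Mochizuki2012, status: disputed] -/
theorem h25_piV_of_proSigmaPart [T2Space D.PiTp] (A : StableCurveAgreement W C D) (h24i : D.Prop24i)
    (hNT : IsNormallyTerminal D.ιX.range) (hrel : Def23_ii C W.piV W.piPM)
    (hPx : ∀ x : D.Cusp, ∃ Q : Subgroup D.DeltaTp, Q ≤ D.inertiaTp x ∧ IsCompact (Q : Set D.DeltaTp) ∧
      (Q : Set D.DeltaTp).Infinite ∧ IsProSigma D.graph.Sigma Q ∧ TotallyDisconnectedSpace Q)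
    {I : Subgroup W.Corhat} (hI : C.IsCuspidalInertia W.piV I) :
    ∀ γ' : W.Corhat, γ' ∈ W.pmHat ⊓ W.aug.ker →
      I.map (MulAut.conj γ').toMonoidHom ≤ W.piPM → γ' ∈ W.piPM := by
  intro γ' hγ' hc
  have hγ'hat : γ'⁻¹ ∈ W.pmHat := W.pmHat.inv_mem (Subgroup.mem_inf.mp hγ').1
  have hI' : I ≤ W.piPM.map (MulAut.conj γ'⁻¹).toMonoidHom := by
    intro x hx
    rw [Subgroup.mem_map_equiv, MulAut.conj_symm_apply, inv_inv]
    exact hc ⟨x, hx, rfl⟩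
  have hE := A.inputA1_of_proSigmaPart h24i hrel hPx hI γ'⁻¹ hγ'hat hI'
  exact (Subgroup.inv_mem_iff W.piPM).mp (A.inputA2_of_normallyTerminal hNT γ'⁻¹ hγ'hat hE)

/-- **IUTchII:Cor2.4(i)** (kurims pp.70–71) `h25_piV_of_proSigmaPart` with the normal terminality supplied by abc-iut-L5-t1's
typed [IUTchI] Prop 2.4 (iii) (`D.Prop24iii`). PROVED. [claim: Mochizuki2012, status: disputed] -/
theorem h25_piV_of_proSigmaPart_of_prop24iii [T2Space D.PiTp] (A : StableCurveAgreement W C D)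
    (h24i : D.Prop24i) (h24iii : D.Prop24iii) (hrel : Def23_ii C W.piV W.piPM)
    (hPx : ∀ x : D.Cusp, ∃ Q : Subgroup D.DeltaTp, Q ≤ D.inertiaTp x ∧ IsCompact (Q : Set D.DeltaTp) ∧
      (Q : Set D.DeltaTp).Infinite ∧ IsProSigma D.graph.Sigma Q ∧ TotallyDisconnectedSpace Q)
    {I : Subgroup W.Corhat} (hI : C.IsCuspidalInertia W.piV I) :
    ∀ γ' : W.Corhat, γ' ∈ W.pmHat ⊓ W.aug.ker →
      I.map (MulAut.conj γ').toMonoidHom ≤ W.piPM → γ' ∈ W.piPM :=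
  A.h25_piV_of_proSigmaPart h24i h24iii.pi.isNormallyTerminal hrel hPx hI

end StableCurveAgreement

end PlusMinusTower

end Literature.IUT.HodgeArakelov
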